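import Mathlib
import Summits.Langlands.Langlands.Theorems.CapacityClassicalityHilbertIntegralOverconvergentIsCongruenceStubCubeIntegralTranslate

/-!
# Crux `HilbertIntegralOverconvergentIsCongruence` (stmt-Langlands-8485), line `Sketch-ideate-r1-k1`,
# section K (Götzky–Koecher): stub `stub_cubeIntegral_intLinear` (K-A2)

Section K of the line proves the Götzky–Koecher principle (Freitag, *Hilbert Modular Forms*, I.4.9)
for Fourier coefficients defined as integrals over the unit cube `[0,1]^ι` in integral-basis
coordinates.  This file proves the registered stub `stub_cubeIntegral_intLinear`: the integral over
the closed unit cube `Set.Icc 0 1 ⊆ ι → ℝ` of a `ℤ^ι`-periodic function `g : (ι → ℝ) → ℂ` is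
invariant under the linear substitution `x ↦ U x` for an integer matrix `U` that is invertible over
`ℤ` (`U * V = 1`), with NO integrability or measurability hypothesis on `g`.  In the line it is
applied to the matrix of multiplication by a unit in an integral basis.

Proof.  Let `T x = U_ℝ x` be the real linear automorphism given by `U` (inverse `V_ℝ`,
`Matrix.toLin'OfInv`).  Since `det U · det V = 1` in `ℤ`, `|det U_ℝ| = 1`, so `T` preserves Lebesgue
measure (`Real.map_matrix_volume_pi_eq_smul_volume_pi`), and
`∫_C g (T x) dx = ∫_{T '' C} g` for the half-open cube `C = ZSpan.fundamentalDomain (Pi.basisFun ℝ ι)`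
(a.e. equal to the closed cube).  Now `T '' C` is the fundamental domain of the basis
`(Pi.basisFun ℝ ι).map T` (`ZSpan.map_fundamentalDomain`), whose `ℤ`-span is again the integer
lattice `L` because `U` and `V` have integer entries; hence `C` and `T '' C` are both fundamental
domains for `L`, `g` is `L`-invariant, and `IsAddFundamentalDomain.setIntegral_eq` (which needs no
integrability) gives `∫_{T '' C} g = ∫_C g`.
-/

set_option linter.dupNamespace false -- mandated namespace `Summit.Langlands.Langlands.…` repeats a component

namespace Summit.Langlands.Langlands.Theorems.HilbertIntegralOverconvergentIsCongruence

open MeasureTheory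

/-- Integer vectors lie in the `ℤ`-span of the standard basis of `ι → ℝ`. -/
theorem kA2_intCast_mem_span {ι : Type} [Fintype ι] (m : ι → ℤ) :
    (fun i ↦ (m i : ℝ)) ∈ Submodule.span ℤ (Set.range (Pi.basisFun ℝ ι)) :=
  ((Pi.basisFun ℝ ι).mem_span_iff_repr_mem ℤ _).mpr fun i ↦ ⟨m i, by simp⟩

/-- An integer matrix (read as a real matrix) maps the integer lattice of `ι → ℝ` into itself. -/
theorem kA2_mulVec_mem_span {ι : Type} [Fintype ι] (U : Matrix ι ι ℤ) {w : ι → ℝ}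
    (hw : w ∈ Submodule.span ℤ (Set.range (Pi.basisFun ℝ ι))) :
    (U.map (Int.cast : ℤ → ℝ)).mulVec w ∈ Submodule.span ℤ (Set.range (Pi.basisFun ℝ ι)) := by
  obtain ⟨m, rfl⟩ := kA1_exists_intCast_eq_of_mem_span hw
  have h : (U.map (Int.cast : ℤ → ℝ)).mulVec (fun i ↦ (m i : ℝ)) =
      fun i ↦ ((U.mulVec m) i : ℝ) := by
    funext i
    exact ((Int.castRingHom ℝ).map_mulVec U m i).symm
  rw [h]
  exact kA2_intCast_mem_span (U.mulVec m)

/-- For a linear automorphism `T` of `ι → ℝ` preserving Lebesgue measure and mapping the integer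
lattice onto itself, the integral over the closed unit cube of a `ℤ^ι`-periodic function is
invariant under the substitution `x ↦ T x` (no integrability hypothesis). -/
theorem kA2_setIntegral_comp_linearEquiv {ι : Type} [Fintype ι] (g : (ι → ℝ) → ℂ)
    (hper : ∀ (m : ι → ℤ) (x : ι → ℝ), g (x + fun i ↦ (m i : ℝ)) = g x)
    (T : (ι → ℝ) ≃ₗ[ℝ] (ι → ℝ)) (hT : MeasurePreserving T volume volume)
    (hTL : ∀ w ∈ Submodule.span ℤ (Set.range (Pi.basisFun ℝ ι)),
      T w ∈ Submodule.span ℤ (Set.range (Pi.basisFun ℝ ι)))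
    (hTL' : ∀ w ∈ Submodule.span ℤ (Set.range (Pi.basisFun ℝ ι)),
      T.symm w ∈ Submodule.span ℤ (Set.range (Pi.basisFun ℝ ι))) :
    ∫ x in Set.Icc (0 : ι → ℝ) 1, g (T x) = ∫ x in Set.Icc (0 : ι → ℝ) 1, g x := by
  haveI : Countable (Submodule.span ℤ (Set.range (Pi.basisFun ℝ ι))).toAddSubgroup := by
    change Countable (Submodule.span ℤ (Set.range (Pi.basisFun ℝ ι)))
    infer_instance
  have hC : ZSpan.fundamentalDomain (Pi.basisFun ℝ ι) =ᵐ[volume] Set.Icc (0 : ι → ℝ) 1 := by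
    rw [ZSpan.fundamentalDomain_pi_basisFun]
    exact Measure.univ_pi_Ico_ae_eq_Icc (μ := fun _ : ι ↦ (volume : Measure ℝ)) (f := 0) (g := 1)
  have hinv : ∀ (w : (Submodule.span ℤ (Set.range (Pi.basisFun ℝ ι))).toAddSubgroup) (x : ι → ℝ),
      g (w +ᵥ x) = g x := by
    rintro ⟨w, hw⟩ x
    obtain ⟨m, rfl⟩ := kA1_exists_intCast_eq_of_mem_span hw
    rw [AddSubgroup.mk_vadd, vadd_eq_add, add_comm, hper]
  -- the `ℤ`-span of the image basis `b.map T` is the same integer lattice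
  have hL : Submodule.span ℤ (Set.range ((Pi.basisFun ℝ ι).map T)) =
      Submodule.span ℤ (Set.range (Pi.basisFun ℝ ι)) := by
    rw [← ZSpan.map (Pi.basisFun ℝ ι) T]
    refine le_antisymm (Submodule.map_le_iff_le_comap.mpr ?_) ?_
    · intro w hw
      exact hTL w hw
    · intro w hw
      exact Submodule.mem_map.mpr ⟨T.symm w, hTL' w hw, T.apply_symm_apply w⟩
  -- hence the image of the half-open cube is again a fundamental domain of the integer lattice
  have hD : IsAddFundamentalDomain (Submodule.span ℤ (Set.range (Pi.basisFun ℝ ι))).toAddSubgroup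
      (T '' ZSpan.fundamentalDomain (Pi.basisFun ℝ ι)) volume := by
    rw [ZSpan.map_fundamentalDomain, ← hL]
    exact ZSpan.isAddFundamentalDomain' ((Pi.basisFun ℝ ι).map T) volume
  have hemb : MeasurableEmbedding T := T.toContinuousLinearEquiv.toHomeomorph.measurableEmbedding
  calc ∫ x in Set.Icc (0 : ι → ℝ) 1, g (T x)
      = ∫ x in ZSpan.fundamentalDomain (Pi.basisFun ℝ ι), g (T x) :=
        (setIntegral_congr_set hC).symm
    _ = ∫ y in T '' ZSpan.fundamentalDomain (Pi.basisFun ℝ ι), g y :=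
        (hT.setIntegral_image_emb hemb g _).symm
    _ = ∫ x in ZSpan.fundamentalDomain (Pi.basisFun ℝ ι), g x :=
        hD.setIntegral_eq (ZSpan.isAddFundamentalDomain' (Pi.basisFun ℝ ι) volume) hinv
    _ = ∫ x in Set.Icc (0 : ι → ℝ) 1, g x := setIntegral_congr_set hC

/-- **stub K-A2 — `stub_cubeIntegral_intLinear`** (registered signature): the integral over the
closed unit cube `[0,1]^ι` of a `ℤ^ι`-periodic function `g : (ι → ℝ) → ℂ` is invariant under the
linear substitution `x ↦ U x` for an integer matrix `U` invertible over `ℤ` (`U * V = 1`); no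
integrability hypothesis (the half-open cube and its image under `U` are both fundamental domains of
`ℤ^ι`, `|det U| = 1`, and `[0,1]^ι =ᵐ [0,1)^ι`). -/
theorem stub_cubeIntegral_intLinear {ι : Type} [Fintype ι] [DecidableEq ι] (g : (ι → ℝ) → ℂ)
    (hper : ∀ (m : ι → ℤ) (x : ι → ℝ), g (x + fun i ↦ (m i : ℝ)) = g x)
    (U V : Matrix ι ι ℤ) (hUV : U * V = 1) :
    ∫ x in Set.Icc (0 : ι → ℝ) 1, g ((U.map (Int.cast : ℤ → ℝ)).mulVec x) =
      ∫ x in Set.Icc (0 : ι → ℝ) 1, g x := by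
  -- the real matrices `U_ℝ`, `V_ℝ` are inverse to each other
  have hAB : U.map (Int.cast : ℤ → ℝ) * V.map (Int.cast : ℤ → ℝ) = 1 := by
    have h : (U * V).map (Int.castRingHom ℝ) =
        U.map (Int.castRingHom ℝ) * V.map (Int.castRingHom ℝ) := Matrix.map_mul
    rw [hUV, Matrix.map_one _ (map_zero _) (map_one _)] at h
    exact h.symm
  have hBA : V.map (Int.cast : ℤ → ℝ) * U.map (Int.cast : ℤ → ℝ) = 1 := mul_eq_one_comm.mp hAB
  -- `|det U_ℝ| = 1`
  have hdet : |(U.map (Int.cast : ℤ → ℝ)).det| = 1 := by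
    have hU : |U.det| = 1 := Int.isUnit_iff_abs_eq.mp (Matrix.isUnit_det_of_right_inverse hUV)
    have h : ((U.det : ℤ) : ℝ) = (U.map (Int.cast : ℤ → ℝ)).det := Int.cast_det U
    rw [← h, ← Int.cast_abs, hU, Int.cast_one]
  -- the linear automorphism `T x = U_ℝ x`, with inverse `V_ℝ`
  let T : (ι → ℝ) ≃ₗ[ℝ] (ι → ℝ) := Matrix.toLin'OfInv hBA hAB
  have hT : MeasurePreserving T volume volume := by
    refine ⟨T.toContinuousLinearEquiv.continuous.measurable, ?_⟩
    have hmap := Real.map_matrix_volume_pi_eq_smul_volume_pi (M := U.map (Int.cast : ℤ → ℝ))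
      (fun h0 ↦ zero_ne_one (by rw [h0, abs_zero] at hdet; exact hdet))
    rw [abs_inv, hdet, inv_one, ENNReal.ofReal_one, one_smul] at hmap
    exact hmap
  have hTL : ∀ w ∈ Submodule.span ℤ (Set.range (Pi.basisFun ℝ ι)),
      T w ∈ Submodule.span ℤ (Set.range (Pi.basisFun ℝ ι)) := fun w hw ↦ kA2_mulVec_mem_span U hw
  have hTL' : ∀ w ∈ Submodule.span ℤ (Set.range (Pi.basisFun ℝ ι)),
      T.symm w ∈ Submodule.span ℤ (Set.range (Pi.basisFun ℝ ι)) :=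
    fun w hw ↦ kA2_mulVec_mem_span V hw
  exact kA2_setIntegral_comp_linearEquiv g hper T hT hTL hTL'

end Summit.Langlands.Langlands.Theorems.HilbertIntegralOverconvergentIsCongruence
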